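import Summits.ResolutionOfSingularities.ResolutionOfSingularities.Theorems.PurelyInseparableDim4IsolatedOrderDichotomy
import Mathlib.RingTheory.MvPolynomial.EulerIdentity
import HarnessLib
import HarnessLib.Audit.Tags

/-!
# Purely inseparable dim 4 — `ē ≤ 2` on the floor: a degree-`p` form never has a `1`-dimensional gradient span

F4-I(3,3) (WORD #35 (b)), the TANGENT-CONE ("floor") half: the entrance hypothesis of
[CJS 2020] Def. 5.38 / Thm. 5.40 (arXiv numbering; LNM 2270 Def. 6.38 / Thm. 6.40) and Cor. 5.37 is
`e_x(X) = ē_x(X) ≤ 2`.  In the frame, `ē` of the cone `Z^p + F_p(U)` is `dim_K A(F_p)`, the additive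
subspace of the initial form (`PointBlowup.additiveSubspace`, kernel of the polar map; `dim A + dim ∇ = 4`,
`PointBlowup.finrank_additiveSubspace_add_finrank_gradSpan`).  The tree had `1 ≤ ē ≤ 3` along
`Step0` chains of order `p` (`Directrix.step0_chain_letter_bounds`).  This file removes the value `3`:

* `Directrix.sum_X_mul_pderiv_eq_zero` — Euler in characteristic `p`: `Σ Uᵢ ∂ᵢΦ = p • Φ = 0` for a
  form of degree `p`.
* `Directrix.finrank_gradSpan_ne_one` — hence **`dim ∇Φ ≠ 1`** (if `∇Φ = K·Q`, `∂ᵢΦ = aᵢ Q`, then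
  `(Σ aᵢ Uᵢ)·Q = 0` forces `a = 0`), so `∇Φ ≠ 0 ⇒ dim ∇Φ ≥ 2 ⇒ dim A(Φ) ≤ n − 2`
  (`two_le_finrank_gradSpan`, `finrank_additiveSubspace_add_two_le`) — any number of variables.
* `Directrix.finrank_additiveSubspace_initialForm_le_two` — **`ē ≤ 2` at every CLEAN state of order
  `p`** in the frame (`n = 4`); along a `Step0 p` chain every state of index `≥ 1` is clean, so on the
  order-`p` tail `1 ≤ ē ≤ 2` (`step0_chain_finrank_additiveSubspace_le_two`) and `ē` is eventually
  constant with value `1` or `2` (`step0_chain_eventually_one_or_two`) — exactly the dichotomy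
  Cor. 5.37 (`e = 1`) / Thm. 5.40 (`e = ē = 2`) of [CJS 2020] is stated for; at `(p, q) = (3, 3)` this
  applies to the whole "cone" half of `IsolatedBand.noIsolatedTrap_three_three_of_band_and_cone`
  (`isolated_cone_chain_eventually_one_or_two`).

OURS (frame reading of a folklore identity); nothing here proves `NoIsolatedTrap 3 3` or resolution in
dimension `≥ 4` / characteristic `p`.  Supports stmt-ResolutionOfSingularities-16155 (helper).
-/

set_option linter.dupNamespace false -- mandated namespace of this single-conjunct summit

namespace Summit.ResolutionOfSingularities.ResolutionOfSingularities.Theorems.PIDim4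

namespace Directrix

open MvPolynomial Finset
open Literature.AlgebraicGeometry.Resolution
open Literature.AlgebraicGeometry.Resolution.Hauser2010
open Literature.AlgebraicGeometry.Resolution.HauserPerlega2019
open Literature.Barriers.ResolutionOfSingularities
open PointBlowup (gradSpan additiveSubspace)

/-! ## 1. Euler in characteristic `p` and `dim ∇Φ ≠ 1` (any number of variables) -/

section General

variable {σ : Type} {K : Type} [Field K] [Fintype σ]

/-- **Euler's identity in characteristic `p`**: for a form `Φ` of degree `p`, `Σᵢ Uᵢ ∂ᵢΦ = p • Φ = 0`.
[folklore] -/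
theorem sum_X_mul_pderiv_eq_zero (p : ℕ) [CharP K p] {Φ : MvPolynomial σ K}
    (hΦ : Φ.IsHomogeneous p) : ∑ i, X i * pderiv i Φ = 0 := by
  rw [hΦ.sum_X_mul_pderiv, ← Nat.cast_smul_eq_nsmul K, CharP.cast_eq_zero, zero_smul]

/-- **A form of degree `p` in characteristic `p` never has a `1`-dimensional gradient span**: if
`∇Φ = K·Q` with `Q ≠ 0` then `∂ᵢΦ = aᵢ Q` and Euler gives `(Σᵢ aᵢ Uᵢ)·Q = 0`, so `a = 0` and
`∇Φ = 0`, a contradiction. [folklore] -/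
theorem finrank_gradSpan_ne_one (p : ℕ) [CharP K p] {Φ : MvPolynomial σ K}
    (hΦ : Φ.IsHomogeneous p) : Module.finrank K (gradSpan Φ) ≠ 1 := by
  classical
  intro h1
  obtain ⟨⟨Q, hQ⟩, hQ0, hgen⟩ := finrank_eq_one_iff'.mp h1
  have hQne : Q ≠ 0 := fun h => hQ0 (Subtype.ext h)
  have hmem : ∀ i : σ, pderiv i Φ ∈ gradSpan Φ := fun i => Submodule.subset_span ⟨i, rfl⟩
  choose a ha using fun i => hgen ⟨pderiv i Φ, hmem i⟩
  have ha' : ∀ i, pderiv i Φ = C (a i) * Q := fun i => by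
    have h := congrArg Subtype.val (ha i)
    rw [Submodule.coe_smul, smul_eq_C_mul] at h
    exact h.symm
  have hE := sum_X_mul_pderiv_eq_zero p hΦ
  have hprod : (∑ i, C (a i) * X i) * Q = 0 := by
    rw [Finset.sum_mul, ← hE]
    exact Finset.sum_congr rfl fun i _ => by rw [ha' i]; ring
  rcases mul_eq_zero.mp hprod with hlin | hQ'
  · have ha0 : ∀ i, a i = 0 := by
      have hsum : ∑ i, a i • (X i : MvPolynomial σ K) = 0 := by
        rw [← hlin]
        exact Finset.sum_congr rfl fun i _ => smul_eq_C_mul (X i) (a i)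
      exact Fintype.linearIndependent_iff.mp (linearIndependent_X σ K) a hsum
    have hbot : gradSpan Φ = ⊥ := by
      rw [gradSpan, Submodule.span_eq_bot]
      rintro _ ⟨i, rfl⟩
      simp only [ha' i, ha0 i, C_0, zero_mul]
    rw [hbot, finrank_bot] at h1
    exact zero_ne_one h1
  · exact hQne hQ'

/-- Hence `∇Φ ≠ 0 ⇒ dim ∇Φ ≥ 2` for a form of degree `p` in characteristic `p`. [folklore] -/
theorem two_le_finrank_gradSpan (p : ℕ) [CharP K p] {Φ : MvPolynomial σ K}
    (hΦ : Φ.IsHomogeneous p) (hne : gradSpan Φ ≠ ⊥) : 2 ≤ Module.finrank K (gradSpan Φ) := by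
  have h0 : Module.finrank K (gradSpan Φ) ≠ 0 := by
    rwa [Ne, Submodule.finrank_eq_zero]
  have h1 := finrank_gradSpan_ne_one p hΦ
  omega

/-- **`dim A(Φ) ≤ n − 2`** for a form of degree `p` in characteristic `p` with `∇Φ ≠ 0`
(`dim A + dim ∇ = n`). [folklore] -/
theorem finrank_additiveSubspace_add_two_le (p : ℕ) [CharP K p] {Φ : MvPolynomial σ K}
    (hΦ : Φ.IsHomogeneous p) (hne : gradSpan Φ ≠ ⊥) :
    Module.finrank K (additiveSubspace Φ) + 2 ≤ Fintype.card σ := by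
  have h := PointBlowup.finrank_additiveSubspace_add_finrank_gradSpan (K := K) Φ
  have h2 := two_le_finrank_gradSpan p hΦ hne
  omega

end General

/-! ## 2. The frame (`n = 4`): `ē ≤ 2` at clean states of order `p`, and along `Step0` chains -/

section Frame

variable {K : Type} [Field K]

/-- **`ē ≤ 2` at every clean state of order `p`**: `dim_K A(F_p) ≤ 2` when `ord₀ F = p` and `F` is
clean (`∇F_p ≠ 0` by `gradSpan_initialForm_ne_bot_of_isClean`, then §1).  This is the entrance
hypothesis `ē_x(X) ≤ 2` of [CJS 2020] Cor. 5.37 / Def. 5.38 for the cone `Z^p + F_p(U)`, read through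
`dim A(F_p) = ē` (`PointBlowup.inRidge_initialForm_iff_mem_additiveSubspace`). [OURS · frame reading]
[cite: CossartJannsenSaito2020, Def. 2.18, Def. 2.21 and Def. 5.38] -/
theorem finrank_additiveSubspace_initialForm_le_two (p : ℕ) [Fact p.Prime] [CharP K p]
    {F : MvPolynomial (Fin 4) K} (hord : ordZero F = p) (hclean : HauserPerlega.IsClean p F) :
    Module.finrank K (additiveSubspace (initialForm F)) ≤ 2 := by
  have hne := gradSpan_initialForm_ne_bot_of_isClean p hord hclean
  have h := finrank_additiveSubspace_add_two_le p (initialForm_isHomogeneous hord) hne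
  rw [Fintype.card_fin] at h
  omega

/-- **`1 ≤ ē ≤ 2` on the order-`p` tail of a `Step0 p` chain**: every state of index `≥ 1` is clean
(`IsolatedBand.isClean_of_step0`), so at each such state of order `p`, `1 ≤ dim A(F_p) ≤ 2`
(`≥ 1`: it has a `Step0` successor, `Directrix.one_le_finrank_additiveSubspace_of_step0`).
[OURS · frame reading] [cite: CossartJannsenSaito2020, Thm. 3.14 and Def. 5.38] -/
theorem step0_chain_finrank_additiveSubspace_le_two (p : ℕ) [Fact p.Prime] [CharP K p]
    [DecidableEq K] {c : ℕ → State K} (hc : ∀ k, Step0 p (c k) (c (k + 1))) {k : ℕ} (hk : 1 ≤ k)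
    (hord : ordZero (c k).F = p) :
    1 ≤ Module.finrank K (additiveSubspace (initialForm (c k).F)) ∧
      Module.finrank K (additiveSubspace (initialForm (c k).F)) ≤ 2 := by
  refine ⟨one_le_finrank_additiveSubspace_of_step0 p hord (hc k), ?_⟩
  obtain ⟨k', rfl⟩ := Nat.exists_eq_add_of_le' hk
  exact finrank_additiveSubspace_initialForm_le_two p hord (IsolatedBand.isClean_of_step0 (hc k'))

/-- **`ē` stabilises at `1` or `2`**: along a `Step0 p` chain, from any state of index `k₀ ≥ 1` and
order `p` on, the order stays `p` (`IsolatedBand.ordZero_eq_of_le`), `ē = dim A(F_p)` is antitone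
(`Directrix.step0_chain_antitone`), hence eventually constant, and the stable value is `1` or `2`
(never `3`: §1) — the two cases [CJS 2020] Cor. 5.37 (`e = 1`) and Thm. 5.40 (`e = ē = 2`) are
stated for. [OURS · frame reading] [cite: CossartJannsenSaito2020, Cor. 5.37 and Thm. 5.40] -/
theorem step0_chain_eventually_one_or_two (p : ℕ) [Fact p.Prime] [CharP K p] [DecidableEq K]
    {c : ℕ → State K} (hc : ∀ k, Step0 p (c k) (c (k + 1))) {k₀ : ℕ} (hk₀ : 1 ≤ k₀)
    (hord : ordZero (c k₀).F = p) :
    ∃ N e, k₀ ≤ N ∧ (e = 1 ∨ e = 2) ∧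
      ∀ k, N ≤ k → Module.finrank K (additiveSubspace (initialForm (c k).F)) = e := by
  -- the shifted chain `k ↦ c (k₀ + k)` starts at a clean state of order `p`
  obtain ⟨k', hk'⟩ := Nat.exists_eq_add_of_le' hk₀
  have hclean : HauserPerlega.IsClean p (c k₀).F := by
    rw [hk']
    exact IsolatedBand.isClean_of_step0 (hc k')
  have hg0 : gradSpan (initialForm (c (k₀ + 0)).F) ≠ ⊥ :=
    gradSpan_initialForm_ne_bot_of_isClean p hord hclean
  have hstep' : ∀ k, Step0 p (c (k₀ + k)) (c (k₀ + (k + 1))) := fun k => hc (k₀ + k)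
  obtain ⟨N, hN⟩ := exists_eventually_const_of_antitone _
    (step0_chain_antitone p (fun k => c (k₀ + k)) hstep' hord hg0)
  have hordN : ordZero (c (k₀ + N)).F = p :=
    (step0_chain_ordZero_eq p (fun k => c (k₀ + k)) hstep' hord hg0 N).1
  obtain ⟨h1, h2⟩ :=
    step0_chain_finrank_additiveSubspace_le_two p hc (k := k₀ + N) (by omega) hordN
  refine ⟨k₀ + N, Module.finrank K (additiveSubspace (initialForm (c (k₀ + N)).F)), by omega,
    by omega, fun k hk => ?_⟩
  obtain ⟨m, rfl⟩ := Nat.exists_eq_add_of_le hk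
  have h := hN (N + m) (Nat.le_add_right N m)
  rw [Nat.add_assoc]
  exact h

/-- **At `(p, q) = (3, 3)`, on the cone half**: along an infinite isolated `Step0 3` chain whose orders
are all `3`, `ē ∈ {1, 2}` eventually constant — the entrance data of [CJS 2020] Cor. 5.37 / Thm. 5.40
for the "cone" hypothesis of `IsolatedBand.noIsolatedTrap_three_three_of_band_and_cone`.
[OURS · frame reading] [cite: CossartJannsenSaito2020, Cor. 5.37 and Thm. 5.40] -/
theorem isolated_cone_chain_eventually_one_or_two [CharP K 3] [DecidableEq K] {c : ℕ → State K}
    (hc : ∀ k, IsIsolated 3 (c k).F ∧ Step0 3 (c k) (c (k + 1)) ∧ ordZero (c k).F = (3 : ℕ∞)) :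
    ∃ N e, 1 ≤ N ∧ (e = 1 ∨ e = 2) ∧
      ∀ k, N ≤ k → Module.finrank K (additiveSubspace (initialForm (c k).F)) = e := by
  haveI : Fact (Nat.Prime 3) := ⟨Nat.prime_three⟩
  have h := step0_chain_eventually_one_or_two 3 (c := c) (fun k => (hc k).2.1) (k₀ := 1) le_rfl
    (by exact_mod_cast (hc 1).2.2)
  exact h

end Frame

end Directrix

end Summit.ResolutionOfSingularities.ResolutionOfSingularities.Theorems.PIDim4
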